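import Summits.QuantumFields.QCD.Theorems.MobilityGap.Negative.LowerPin
import Literature.MathematicalPhysics.QuantumFieldTheory.QCDOS

/-!
# Crux `ChiralMobilityGap` (stmt-QuantumFields-17497), line `Sketch`, stub A `stub_slowChannel`

Pure analysis: **one slow channel kills the uniform lattice gap** (fixed `k`, `S = n → ∞`).
If ONE pair of gauge-invariant local lattice QCD observables `A, B` satisfies, eventually in `k`, on
every torus `S ≥ L_k` and at every Euclidean-time separation `n ≤ S`, the lower bound
`c e^{-(r a_k n + p log(n+1))} ≤ ‖⟨A · τ_{n e₀}B⟩^conn_{k,2S+1}‖` with `c > 0`, then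
`sch.HasLatticeMassGap ε` fails for every `ε > r`: assuming the gap, at ONE large `k` both the gap
bound `≤ C e^{-ε a_k n}` and the lower bound hold for all `n ≥ L_k` (take the torus `S := n`), and
`MobilityGapNegative.no_rate_sandwich` with `A := r a_k < B := ε a_k` (`a_k > 0`) is contradicted.
-/

noncomputable section

namespace Summit.QuantumFields.QCD.Theorems.ChiralMobilityGapSketch

open scoped BigOperators Topology
open MeasureTheory Filter Set
open Literature.MathematicalPhysics.QuantumFieldTheory Literature.MathematicalPhysics.QuantumLattice
  Literature.Probability.LatticeModels
open Summit.QuantumFields.QCD.Theorems.MobilityGapNegative (bare fm Clauses Lower Sign)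

/-- **One slow channel kills the uniform lattice gap** (fixed `k`, `S = n → ∞`): if ONE pair of
observables has `c e^{-(r a_k n + p log(n+1))} ≤ ‖⟨A · τ_{n e₀}B⟩^conn_{k,2S+1}‖` eventually in `k`
for all `S ≥ L_k`, `n ≤ S` (`c > 0`), then `HasLatticeMassGap ε` fails for every `ε > r`: at one
large `k` the gap bound `≤ C e^{-ε a_k n}` and the lower bound hold for all `n ≥ L_k` on the torus
`S = n`, which `no_rate_sandwich` (`r a_k < ε a_k`) forbids. -/
theorem stub_slowChannel :
    ∀ {Nf : ℕ} (sch : QCDScheme Nf) {ε r c p : ℝ}, r < ε → 0 < c →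
      ∀ {R R' : ℕ} (A : QCDLatticeObservable Nf R) (B : QCDLatticeObservable Nf R'),
        (∀ᶠ k in atTop, ∀ S : ℕ, sch.L k ≤ S → ∀ n : ℕ, n ≤ S →
          c * Real.exp (-(r * (sch.a k * n) + p * Real.log (n + 1))) ≤
            ‖qcdLatticeConnectedCorr (sch.β k) (2 * S + 1) (fun fl => sch.mq fl k) A B n‖) →
        ¬ sch.HasLatticeMassGap ε := by
  intro Nf sch ε r c p hrε hc R R' A B hlow hgap
  -- the gap constant of the channel `(A, B)` and its eventual-in-`k` bound
  obtain ⟨C, hC⟩ := hgap R R' A B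
  -- one `k` at which BOTH the lower bound and the gap bound hold on every torus `S ≥ L_k`
  obtain ⟨k, hk₁, hk₂⟩ := (hlow.and hC).exists
  refine Summit.QuantumFields.QCD.Theorems.MobilityGapNegative.no_rate_sandwich
    (A := r * sch.a k) (B := ε * sch.a k) (C := C) (p := p) hc
    (mul_lt_mul_of_pos_right hrε (sch.a_pos k)) (sch.L k) fun n hn => ?_
  -- at `S := n ≥ L_k` and separation `n ≤ S`
  have h1 := hk₁ n hn n le_rfl
  have h2 := hk₂ n hn n le_rfl
  have e1 : r * sch.a k * (n : ℝ) = r * (sch.a k * n) := mul_assoc _ _ _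
  have e2 : ε * sch.a k * (n : ℝ) = ε * (sch.a k * n) := mul_assoc _ _ _
  rw [e1, e2]
  exact h1.trans h2

end Summit.QuantumFields.QCD.Theorems.ChiralMobilityGapSketch

end
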